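import Summits.AnomalousDissipation.AnomalousDissipation.Theses.TaylorCertificates
import Summits.AnomalousDissipation.AnomalousDissipation.Theorems.TaylorCertificatePair.Negative.Bounds
import Summits.AnomalousDissipation.AnomalousDissipation.Theorems.KolmogorovFloor.Negative.BeatAtRest
import Summits.AnomalousDissipation.AnomalousDissipation.Theorems.KolmogorovFloor.Negative.BelowTaylor
import Summits.AnomalousDissipation.AnomalousDissipation.Theorems.TaylorCertificatesKolmogorovFloorResponseDefs
-- NOTE (v9): `…Negative.CheapStatesKill` and `…Negative.QuietPointKill` are LANDED but not yet served by the farm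
-- snapshot (`remote:stale:unbuilt` since 08:5xZ); the two (F9) mirrors below therefore stay `sorry`-backed mirrors
-- of landed theorems until the snapshot catches up (then: import both modules and replace the two `sorry`s by the
-- tree names, as spelled out in their docstrings).

/-!
# Disproof of `KolmogorovFloor` (stmt-AnomalousDissipation-15122, restored from 14030) — standing adversary's work file

v10 — cdisprove seat `refuter-cdisprove-stmt-AnomalousDissipation-15122-0`, 2026-08-16 (cycle 1 on the RESTORED item),
extending v6–v8 of seat `refuter-cdisprove-stmt-AnomalousDissipation-14030-0` (findings (F0)–(F10) below are theirs and
stand; (F11)–(F14) are new; (F14) at the END records what this seat LANDED in cycle 1 — CHEAP numerics/budgets/far-field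
accepted, `stub_cheap` proposed — and the state of the line). STATUS AT v9: the statement is byte-identical to the mooted stmt-14030; the reduction
`CheapSteadyEulerStates → ¬KolmogorovFloor` is LANDED (`Negative/CheapStatesKill.lean`, the "kill witness in tree" of the
restore note; the two (F9) mirrors quote it — their import waits for the farm snapshot, see the NOTE above); the crux chain on
15122 has a line lead (`prover-line-stmt-AnomalousDissipation-15122-0`, PICKED `digit-frame-closure`) whose DEFINITIONS file
`Theorems/TaylorCertificatesKolmogorovFloorResponseDefs.lean` (p98066) is landed and imported here. NEW FINDINGS:
* (F11) INDEPENDENT DERIVATION + EXACT VERIFICATION OF THE LANDED CLOSED FORMS (this seat). I re-derived the inviscid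
  linear response of the shear `U = sin(2πξ·x)e` on a mode line `k + ℤξ` from scratch in the integer triad
  `(e, ξ, n)` (Y-closure identity `2τ_m(E_{m−1}+E_{m+1}) = (E_{m+1}−E_{m−1})|k_m|²`, i.e. `E_{m±1} = N_m ± 2T_m`; a
  pressure-free chain for the `w = c e − a n` component; `x, z` from solenoidality) and transcribed the lead's Lean
  definitions (`sigmaC, rhoC, rhoT, lamP, lamM, Lam, yC, incC, PC, xC, zC, qC, ReC, RxC, RnC`, digit frame
  `digitXi/digitE`, `n = ξ × e`) LITERALLY into exact rational arithmetic (`num/lead_mirror.py`, π := 1 — every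
  sequence is homogeneous of degree −1 in π): for `L ≤ 3` (all 6/32/122 forced modes `0 < k·k ≤ L²`), `J ∈ {0,1,2,5}`
  and random rational transversal forcings, `ReC = RxC = RnC = 0` EXACTLY at every site `|m| ≤ 2J+1`, transversality
  `a x_m + T_m y_m + c z_m = 0` EXACTLY, both edge sites `m = ±(2J+2)` non-zero as designed, and the frame side
  conditions `a ≠ 0, c ≠ 0, k·k < 2|k·ξ|, D > 0, G ≠ 0, E_j ≠ 0` hold for every mode. DET′ in the DIGIT frame
  (`num/det_check.py`, exact): `G(J) ≤ −|k×ξ|²/(4s²X2) < 0` for `L ≤ 6` (924 modes at `L = 6`), `J ≤ 100`, with the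
  ratio `bound/G ∈ [0.4977, 0.5000]` (a clean factor-2 margin, `G → −tan²∠(k,ξ)/(2X2)`), and the side condition
  `9(k·k)² ≤ 4|k×ξ|²` holds for every mode. VERDICT of the stub attack: LINE-ALGEBRA and DET′ are TRUE as typed
  (no mis-statement found); the line is sound. PROOF PLAN for LINE-ALGEBRA recorded in `LineAlgebraPlan` below
  (three scalar identities: `RxC = 0` is the Y-closure identity; `c·e2·ReC − a·n2·RnC = πa(P_{m−1} − P_{m+1} + inc_m)
  = 0` is the chain; `a·ReC + T_m·RxC + c·RnC = 2πaX2(y_{m−1}+y_{m+1}) − q_m N_m = 0` is the definition of `q` plus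
  transversality; the 2×2 system with determinant `D = c²e2 + a²n2 ≠ 0` then forces `ReC = RnC = 0`).
* (F12) AN ALTERNATIVE CLOSURE (this seat, `num/line3.py`, exact): closing the `n`-chain with the pressure symbol
  (`Z_{±J} = 0`, even-site increments `I'_m = [m=0]G_n + μ_m ζ/N2`) instead of the `w`-chain gives the same interior
  equations with determinant `Σ_{m even}(1/E_{m−1} − 1/E_{m+1})/τ_m = −2Σ_{j odd} X2/(E_j τ_{j−1}τ_{j+1}) + edge terms`,
  EVERY term of which is negative after Abel summation (no near-cancellation: `|det| ≥ 2/(9 s²)` for all odd `J`, ratio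
  observed 0.222); recorded as a fallback should DET′'s thin margin ever bite in another frame. Not needed for the
  digit frame (F11).
* (F13) CHEAP BOOKKEEPING IS DECOUPLED (this seat): `Response.ResponseStatement → Response.CheapStatesStatement`
  (= the landed `CheapSteadyEulerStates` by `Iff.rfl`, `cheapStatesStatement_iff` below) needs only landed tools
  (`farField_convect/defect/regular`, `slope_farField_le`, `Torus.integral_inner_eq_sum_freqBall`,
  `mFourierCoeff_fourierTruncate_sub`, `norm_mFourierCoeff_le_of_iterate_bound`/`exists_iterate_bound`,
  `summable_inv_one_add_freqNormSq_pow_card`, `Real.log_le_rpow_div`); recipe and exponent check in the docstring of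
  `cheapStates_of_response_target` (s² = η^{-11/10}/(8π²X2e2), (J+1)² ≈ 3Cb/η, L = L(η) with (2L+1)^{r} ≤ η^{-1/40},
  tail ≤ η² by polynomial Fourier decay of order 40r+4; work via Young's inequality, no Parseval). DONE since v10:
  kernel-checked and split into `Negative/ResponseCheap{Numerics,Budgets,FarField}.lean` (ACCEPTED) +
  `Negative/ResponseCheap.lean` (`cheapStatesStatement_of_responseStatement`, proposed) — see (F14).

Crux (route `TaylorCertificates`, rank 2): ONE smooth div-free mean-zero force `f` on `T³` and
`ν`-independent `ε₀, C, Θ, ν₀` such that for every `ν ∈ (0, ν₀)` a cylindrical test functional `Φ₁` whose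
test fields are trigonometric polynomials of degree `≤ N ≤ C ν^{-3/4}` and a weight `θ₁ ∈ [-Θ, 0]` certify
`ε₀ ≤ ν‖∇u‖² + ⟨F_ν(u), Φ₁'(u)⟩ + 2θ₁((u,f) − ν‖∇u‖²)` at EVERY finite-enstrophy `u ∈ H` of the Leray
ball `‖u‖² ≤ 16‖f‖₂²/ν²`.

## Findings (indexed; details in the docstrings below)

* (F0) ELABORATION. The decl elaborates (probe rc 0, one sorry); read back symbol by symbol: no junk
  operator is exploitable by either side (all pairings are Bochner integrals of `L² × C^∞` integrands,
  `toReal` of a finite `ℝ≥0∞`, `rpow` at `ν > 0`); `N = 0` forces `Φ₁' = 0`; `C < 0` or `Θ < 0` make the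
  inner `∃` empty. `kolmogorovFloor_iff : KolmogorovFloor ↔ FloorClass (3/4)` is `Iff.rfl`.
* (F1) NOT TRIVIALLY TRUE. At rest every term but the injection `(f, Φ₁'(0))` vanishes
  (`floor_terms_at_rest`), so any witness has `(f, Φ₁'(0)) ≥ ε₀` at every `ν < ν₀` (`injects_at_rest`)
  and `‖f‖₂ > 0` (`force_ne_zero`): `f = 0`, `Φ₁.m = 0`, `N = 0` are not witnesses.
* (F2) DUAL READING, kernel-checked (`steady_states_loud`, `kolmogorovFloor_false_of_quietSteadyStates`):
  a witness force has ALL its finite-enstrophy steady weak NS states in the ball with non-negative energy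
  defect LOUD (`ν‖∇u‖² ≥ ε₀`) for every `ν < ν₀`; quiet steady states for every force (`QuietSteadyStates`,
  an open dynamical statement, NOT known for any genuinely 3-D `f`) would refute the crux.
* (F3) MONOTONICITY (`floorClass_mono`): `FloorClass β → FloorClass β'` for `β ≤ β'`; the crux is the
  `β = 3/4` member, formally weaker than the dropped `TaylorFloor = FloorClass (1/2)`.
* (F4) WHY 3/4 RESISTS — the kinematic criterion (paper, this seat; docstring of `KinematicCriterion`):
  every KINEMATIC kill (a quiet state `a` whose resolved Euler residual is small, dressed with a
  coords-invisible beat/packet) is governed by two `ν`-free figures of merit of the phantom `a`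
  (degree `Λ_a`, Reynolds defect `R_a`: `div(a⊗a − R_a) + ∇p = f`):
    Regime II (phantom inside the resolution):  `𝔐₁(a) = ‖R_a‖·‖∇a‖₂  must be  ≲ ε₀²(1+2Θ)⁻²C⁻⁴`;
    Regime I  (phantom at the resolution):      `‖R_a‖ ≲ ε₀(1+2Θ)⁻¹C^{-4/3} Λ_a^{-2/3}` AND
                                                `‖∇a‖₂ ≲ ε₀(1+2Θ)⁻¹C^{-8/3} Λ_a^{2/3}`.
  One Beltrami–Nash stage has `𝔐₁ → c_R(f)c_A(f)` (a constant): kills `β < 3/4` and, AT `β = 3/4`, every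
  `C < C_*(f,ε₀,Θ)` (ONE-STAGE-PHANTOM.md of crux dir TaylorFloor, corroborated here) — a calibration, not a
  kill. Regime I is EXACTLY Onsager-critical scaling (`‖∇P_Λv‖₂ ≍ Λ^{2/3}`, stress `≍ Λ^{-2/3}` is K41): a
  kill for all `C` needs approximate standing flows of `f` strictly better than K41 in both defect and
  steepness, or families beating the one-stage defect×steepness product — beyond every stationary
  convex-integration scheme (all `L^∞`; the obstruction is the untransportable interaction `(a₁·∇)a₂`).
  So the crux's kinematic content is a QUANTITATIVE EULER COERCIVITY of `f` (`𝔐*(f) > 0`), strictly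
  stronger than `SmoothEulerCoerciveForce` (#6 = "𝔐* is not attained by an exact smooth solution").
  **(F4′) AMENDMENT (cycle 2) — THE FAR FIELD ESCAPES THE ONE-STAGE LAW.** The analysis above is correct
  for phantoms of energy `O(1)…O(ν^{-1/2})` but its conclusion "no kill in sight" is SUPERSEDED by the
  DRESSED LAMINAR RAY of crux-ideate r1 k3 (`Cruxes/KolmogorovFloor/DRESSED-RAY-r1-3.md`, `SketchIdeator3.lean`):
  `a_ν = ν^{-γ}U + ν^{γ}P_K(L_U⁻¹f)`, `U = sin(2πξ·x)ê` an exact Euler shear with `(U,f) = 0`, `L_U⁻¹f` the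
  INVISCID LINEAR RESPONSE (inhomogeneous Rayleigh equation at `c = 0`, log-singular critical layers,
  truncated at `K = ν^{-7/10}`): along the Euler cone `Q(tU + b/t) = L_Ub + Q(b)/t²`, so accuracy improves
  like `t⁻²` while loudness `νt²‖∇U‖²` only needs `t ≪ ν^{-1/2}` — the defect `den ≍ ν^{5/8}` is `o(ν^{1/2})`
  against the Kolmogorov beat price `O(ν^{-1/2})`, for EVERY `C` (Thm A, paper; Thm B = the response exists for
  every trig-poly force with a non-resonant shear frame, paper + kit j009650/j009978; all smooth forces:
  round-2 card `cheap-steady-euler-closure`, lacunary tall frames). My regime analysis missed it because I only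
  dressed `O(1)`-energy bases. CONSEQUENCE FOR THIS FILE: the crux is now CONDITIONALLY REFUTED on paper; the
  seat's job is to kernel-check the endgame — DONE in cycle 2 as the CHEAP-BASE KILL (F9), which is Thm A /
  Thm A′ with the construction of the base abstracted into four numbers (enstrophy, slope, work, defect).
* (F5) LOAD-BEARING HYPOTHESES of the inner `∀ u`: `eGradNormSq uf ≠ ⊤` IS load-bearing in the formal
  sense (without it `D` is the junk `0` at infinite-enstrophy states and an infinite-enstrophy packet riding
  the compressive direction of `Φ₁'(0)` kills; paper, `false_without_finiteEnstrophy` below); the Leray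
  ball is NOT used by any known adversary (all live at `‖u‖ = O(1)`…`O(ν^{-1/2})`; Poincaré makes the
  sphere `‖u‖ = 4‖f‖/ν` loud: `(1−2θ₁)D ≥ 64π²‖f‖²/ν`) — information for provers: a proof may as well
  certify the floor on all finite-enstrophy states of energy `≤ ε₀/(4π²ν)` and get the rest for free.
* (F6) NATURAL STRENGTHENINGS refuted. IN LEAN, LANDED (this seat, cycle 1, sorry-free, standard axioms):
  `Theorems/KolmogorovFloor/Negative/{Rest (p75669), TwoModes (p75678), EndgameRest (p75689),
  BeatAtRest (p75992)}.lean`: `not_floor_sixth` — NO ν-uniform band-limited floor with `N ≤ Cν^{-1/6}` exists,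
  for ANY force; with `floorClass_mono`: `not_floorClass_le_sixth : β ≤ 1/6 → ¬FloorClass β` (below, PROVED).
  Mechanism: the BEAT AT REST (two unresolved waves beating at the largest resolved coefficient of `Φ₁'(0)`,
  sign of the waves disposes of the energy channel, `ν = s⁻¹²`). STRONGER, ALSO IN LEAN (this seat):
  `Theorems/KolmogorovFloor/Negative/{AxisBeat (p76345), BelowTaylorSupport (p76408), BelowTaylor (p76655)}.lean
  :: not_floor_lt_half`, LANDED — for EVERY `β < 1/2`, every `C, Θ` and EVERY force the class is dead
  (`not_floorClass_lt_half` below)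
  (axis-carrier beat `|p| ≤ 4N+1` + Wiener bound `(f,Φ₁'(0)) ≤ A(f)·max‖Ĝ(k)‖`; price `≍ (1+2Θ)C²(A(f)+1)ν^{1−2β}`);
  at `β = 1/2` the same witness kills only `C² < ε₀/(4500(1+2Θ)(A(f)+1))`. ON PAPER beyond that: every
  `β < 3/4` by one Beltrami–Nash stage (F4).

* (F7) GALERKIN DUAL READING (paper, elementary; `GalerkinLoudFromRest` below): for `u ∈ P_L H` and a test
  field `W ∈ P_N H`, `L ≥ N`, one has `⟨F_ν(u), W⟩ = (F_L(u), W)` with `F_L = P_L P[f + νΔ· − B(·,·)]` the Galerkin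
  vector field, so `d/dt Φ₁(u^L(t)) = ⟨F_ν(u^L), Φ₁'(u^L)⟩` along EVERY Galerkin-`L` trajectory; time-averaging the
  floor along the Galerkin solution from rest (it stays in the Leray ball, has finite enstrophy, and its energy
  identity signs the `θ₁`-channel away) gives: KolmogorovFloor(f;ε₀,C,Θ,ν₀) ⇒ for every `ν < ν₀` and EVERY
  truncation level `L ≥ Cν^{-3/4}`, `liminf_T (1/T)∫₀ᵀ ν‖∇u^L‖² ≥ ε₀`. A DNS-checkable necessary condition
  (Kolmogorov-or-better resolved pseudo-spectral NS from rest must show `ν`-uniform dissipation for the witness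
  force) — the rigorous form of the route header's cheapest falsifier (ii), with "at N = Cν^{-1/2}" corrected to
  "at every L ≥ Cν^{-3/4}" (sub-Kolmogorov truncations are NOT constrained by the crux).
* (F8) THE ENERGY CHANNEL CANNOT BEAR LOAD (paper, elementary given the axis-carrier beat of QUIET-POINT-BEAT §2;
  `weights_vanish` below): every witness has `|θ₁(ν)| ≤ K(f,C,Θ)·ν^{1/4}` for all small `ν`. Witness states: the
  LAMINAR RAY `u = A g`, `g` the normalised Fourier mode of `f` at a frequency `k_f` with `f̂(k_f) ≠ 0` (a single
  div-free mode is a steady Euler flow: `I(g,g;W) = 0` for every `W`), `A = |θ₁|(g,f)/((1+2|θ₁|)8π²|k_f|²ν)`: the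
  bare floor there is `−θ₁²(g,f)²/((1+2|θ₁|)16π²|k_f|²ν)`, so the multiplier must supply `≍ θ₁²/ν` through
  `(f,W) − 4π²|k_f|²νA(g,W)`, i.e. carry a resolved coefficient `≳ θ₁²/(νA₋₁(f))` (via `(f,W)`) or `≳ |θ₁|/ν` at
  `k_f` (via `(g,W)`); the coords-invisible axis-carrier beat (`p = m eᵢ`, `p' = p − q`, `|p|,|p'| ≤ 2N + 2|q|`,
  gain `≥ πα²|q|‖Ŵ(q)‖/√3`, price `≍ (1+2Θ)C²ν^{-1/2}α²`) then violates the floor unless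
  `|θ₁| ≲ max((1+2Θ)C²ν^{1/2}/c_f, ν^{1/4}C√((1+2Θ)A₋₁(f))/c_f)`, `c_f = √2‖f̂(k_f)‖`, `A₋₁(f) = Σ‖f̂(k)‖/|k|`.
  For provers: design with `θ₁ = 0` (the channel buys at most `O(ν^{1/4})·|P|`); for planners: `Θ` is decoration
  at every `β > 1/2`. Lean status: needs the axis-carrier frame (the landed `frame_selection`/`wave_frequencies`
  lattice has carriers `|p| ≲ N²`, too expensive above `β = 4/11`) and the three-mode state with a general base
  mode (the landed `inertial_three` fixes the base at `e₂`); M-sized, queued.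
  CYCLE 2: DONE IN LEAN — `Negative/{ThreeModesBase, AxisBeatOffset}.lean` LANDED (p76774, p76782),
  `Negative/LaminarBeat.lean` (floor at the dressed laminar ray) and `Negative/WeightsVanish.lean`
  (`kolmogorovFloor_weights_vanish`, the statement of `weights_vanish` below with `K(f,C,Θ)` explicit) verified
  sorry-free with standard axioms (folder `ScratchWeights.lean` rc 0); proposals in flight.
* (F9) THE CHEAP-BASE KILL — KERNEL OF EVERY KINEMATIC REFUTATION, IN LEAN (cycle 2; folder files
  `SlopeBeat.lean`, `CheapBaseTools.lean`, `CheapBaseKill.lean`, `QuietPointKill.lean`, combined check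
  `ScratchCheap.lean` rc 0, 0 sorry, axioms {propext, Classical.choice, Quot.sound}; proposals in flight to
  `Theorems/KolmogorovFloor/Negative/`). `cheap_base_kill`: per `ν` and AFTER the certificate `(N, Φ₁, θ₁)` is
  revealed, let `a` be smooth solenoidal mean-zero with `‖∇a‖² ≤ E_a`, resolved slope `Σ_{|k|≤N}|k|‖â(k)‖ ≤ S_a`,
  work `|(a,f)| ≤ P_a` and steady-Euler DEFECT `|((a·∇)a − f, W)| ≤ η·max_k|k|‖Ŵ(k)‖` for every band-limited
  solenoidal `W`; if `(1+2Θ)4νE_a + 2ΘP_a ≤ ε₀/4`, `den·Π ≤ ε₀/3` and `5den ≤ 1` with `den := 4π²νS_a + η`,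
  `Π := 32π²(1+2Θ)ν(4N+1)²`, and `2∫‖a‖² + 8 ≤ 16‖f‖²/ν²`, then FLOOR fails at one of `a`, `a ± w` (`w` the
  SLOPE-harvesting axis beat `axis_beat_data_slope`, gain `≥ (9/10)α²|q|‖ĝ‖`, amplitude `α² = 5den`). The `±w`
  symmetrisation replaces every frequency-separation hypothesis: NO structure of `a` beyond the four numbers is
  used. COROLLARIES IN LEAN: `floor_no_quiet_point` — a smooth quiet Euler point of `f` (`P[(v·∇)v] = f`
  weakly) kills EVERY band-limited floor family `N ≤ Cν^{-β}`, `β < 1` (η = 0, `den·Π ≍ ν^{2−2β}`): the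
  QUIET-POINT BEAT of the crux chain (QUIET-POINT-BEAT-r2-6, `β = 1/2` there) kernel-checked on the whole
  sub-dissipative range; `kolmogorovFloor_witness_no_quiet_point` (β = 3/4: the crux implies crux #6
  `SmoothEulerCoerciveForce` FOR ITS OWN FORCE; every designer force `P[(v·∇)v]` — Taylor–Green, two-Beltrami
  products — is dead); `kolmogorovFloor_false_of_quiet_points` (¬#6-for-all-f → ¬KolmogorovFloor). TARGETS
  (cycle 3, `-- Targets` below): `DressedRayKill` (DRESSED-RAY Thm A = `cheap_base_kill` + the trig-poly
  bookkeeping (a1)–(a6) of `a = ν^{-3/8}U + ν^{3/8}b_K` from `ApproxLinearResponse f U`) and the round-2 cut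
  `EndgameFromCheapStates` (`CHEAP(f) →  FloorKillAtFor (3/4) f`), both one bookkeeping lemma away from (F9);
  then `¬KolmogorovFloorPoly` / `¬KolmogorovFloor` follow from the Euler-side statements
  `LinearResponseLemma` / `CheapSteadyEulerStates` as NEGATIVE LEMMAS MODULO those (ν-free) hypotheses.
  UPDATE (cycle 2, later): the round-2 cut is DONE IN LEAN too — folder `CheapStatesKill.lean` (in the combined
  check `ScratchCheap.lean`, rc 0, 0 sorry, standard axioms): `floor_false_of_cheapStates` (CHEAP states of `f`
  for all small `η` ⇒ no Kolmogorov floor family for `f`; `ν := η^{3/2}`, `den·Π = O(η^{3/20})`),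
  `def CheapSteadyEulerStates` (THE INTERFACE for Euler-side seats — mirrored verbatim below as
  `CheapSteadyEulerStates'`; note: smooth states, NO trig-poly/degree requirement, slope bound over every ball,
  defect against `W` given by coefficient vanishing above `N` and slope `≤ M`; only `η < η₀(f)` needed) and
  `kolmogorovFloor_false_of_CheapSteadyEulerStates : CheapSteadyEulerStates → ¬KolmogorovFloor`, to be landed
  `--negative-modulo CheapSteadyEulerStates` once `CheapBaseKill` is in the tree.
* (F10) THE DRESSED RAY AND THE WARM RANGE, IN LEAN (cycle 2, later; folder files `FarField.lean`,
  `FarFieldCheap.lean`, `LinearResponseKill.lean`, `WarmRangeKill.lean`; combined check `ScratchAll.lean` rc 0,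
  0 sorry, standard axioms; landing queued behind `CheapBaseTools` (LANDED p81168) → `CheapBaseKill` →
  `CheapStatesKill`). `farField_convect`: for an exact Euler state `U` (`(U·∇)U = 0`) and `s t = 1`,
  `(a·∇)a − f = [(U·∇)b + (b·∇)U − f] + t²(b·∇)b` for `a = s•U + t•b` — DRESSED-RAY (a5) — with the enstrophy /
  energy / slope / work bookkeeping (a1)–(a4),(a6) (`eGradNormSq_const_smul` etc.). `cheapStates_of_response`:
  an approximate linear response (`b_K`: enstrophy, slope `≤ C_bK`; energy, work `≤ C_b`; linearised defect
  `≤ (C_b/K)·M`; self-advection `≤ C_b(1+log K)·M`) makes CHEAP states (`a = η^{-13/25}U + η^{13/25}b_K`,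
  `K = ⌈2C_b/η⌉`); `floor_false_of_response` and — glued to the literal shapes of
  `SketchIdeator3.ApproxLinearResponse` (`fourierTruncate`, `gradNormSq`, `slopeSum`, `SlopeLE`) —
  `floor_false_of_approxLinearResponse`: THM A OF DRESSED-RAY AT β = 3/4 IS KERNEL-CHECKED, for every force (no
  polynomiality) carrying a work-free Euler state with a response. `floor_false_of_warmRange` (WARM-RANGE-RAY.md of
  r1 k2, kernel-checked): if the LINEARISED steady Euler equation at a work-free exact Euler state `U` has a smooth
  solenoidal mean-zero weak solution `b`, `f` is not a witness (constant response, zero defect, self-advection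
  bounded by the Wiener norm of `(b·∇)b`: `abs_integral_inner_le_tsum_mul_slope`) — strictly more than the designer
  forces of (F9). WHAT IS LEFT for `¬KolmogorovFloor` unconditional: ONLY the Euler-side statement — for every
  admissible `f` an exact smooth work-free Euler state `U` with an approximate linear response (DRESSED-RAY §3: the
  per-mode-line inhomogeneous Rayleigh solve at `c = 0`, log-singular critical layers, `1/j` tails; the lacunary
  frames of the round-2 card for non-polynomial `f`). Every other step is in Lean.

No UNCONDITIONAL kill of the crux is landed yet: the crux is refuted on paper for every trigonometric-
polynomial force with a non-resonant shear frame (DRESSED-RAY Thm A+B) and conditionally for all forces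
(round-2 card); in Lean it is refuted for every force with a smooth quiet Euler point (F9), for every force in the
warm range of a work-free Euler state, and for every force carrying an approximate linear response (F10: Thm A
kernel-checked); the crux is reduced IN LEAN to the ν-free Euler statement `CheapSteadyEulerStates`. Prose lives in docstrings; every `sorry` below
is a documented near-miss, a mirror of a folder theorem in flight, or a paper theorem queued for formalization.
-/

noncomputable section

set_option linter.dupNamespace false

open MeasureTheory UnitAddTorus
open scoped InnerProductSpace ENNReal

namespace Summit.AnomalousDissipation.AnomalousDissipation.Cruxes.KolmogorovFloor.Disproof

open Literature.Analysis.FunctionSpaces Literature.Analysis.FluidPDE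
open Summit.AnomalousDissipation.AnomalousDissipation.Theses.TaylorCertificates
open Summit.AnomalousDissipation.AnomalousDissipation.Theorems.TaylorCertificatePair.Negative

/-! ## The parametrised class and the per-force data -/

/-- The floor data of the crux at ONE viscosity `ν` for the force `f`, floor `ε₀`, resolution constant
`C`, weight bound `Θ` and resolution exponent `β`: some `N ≤ Cν^{-β}`, a band-limited cylindrical `Φ₁`
and `θ₁ ∈ [-Θ,0]` certifying the floor on the finite-enstrophy part of the Leray ball. (Verbatim the
inner block of the route decl with `3/4 ↦ β`.) -/
def FloorDataAt (β : ℝ) (f : UnitAddTorus (Fin 3) → EuclideanSpace ℝ (Fin 3)) (ε₀ C Θ ν : ℝ) : Prop :=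
  ∃ (N : ℕ) (Φ₁ : Literature.Analysis.FluidPDE.Torus.CylindricalTest (Fin 3)) (θ₁ : ℝ), (N : ℝ) ≤ C * ν ^ (-β) ∧ (∀ i, Literature.Analysis.FunctionSpaces.Torus.fourierTruncate N (Φ₁.g i) = Φ₁.g i) ∧ -Θ ≤ θ₁ ∧ θ₁ ≤ 0 ∧ ∀ u : Literature.Analysis.FunctionSpaces.Torus.energySpace (Fin 3), let uf : UnitAddTorus (Fin 3) → EuclideanSpace ℝ (Fin 3) := ((u : MeasureTheory.Lp (EuclideanSpace ℝ (Fin 3)) 2 (MeasureTheory.volume : MeasureTheory.Measure (UnitAddTorus (Fin 3)))) : UnitAddTorus (Fin 3) → EuclideanSpace ℝ (Fin 3)); let D : ℝ := ν * (Literature.Analysis.FunctionSpaces.Torus.eGradNormSq uf).toReal; let P : ℝ := Literature.Analysis.FluidPDE.Torus.pairing (u : MeasureTheory.Lp (EuclideanSpace ℝ (Fin 3)) 2 (MeasureTheory.volume : MeasureTheory.Measure (UnitAddTorus (Fin 3)))) f - D; Literature.Analysis.FunctionSpaces.Torus.eGradNormSq uf ≠ ⊤ → ‖u‖ ^ 2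 ≤ 16 * (∫ x, ‖f x‖ ^ 2) / ν ^ 2 → ε₀ ≤ D + Literature.Analysis.FluidPDE.Torus.nsGeneratorPairing ν f u (Φ₁.grad u) + 2 * θ₁ * P

/-- The floor of exponent `β` FOR the force `f` with constants `ε₀, C, Θ, ν₀`. -/
def FloorFor (β : ℝ) (f : UnitAddTorus (Fin 3) → EuclideanSpace ℝ (Fin 3)) (ε₀ C Θ ν₀ : ℝ) : Prop :=
  0 < ε₀ ∧ 0 < ν₀ ∧ ∀ ν : ℝ, 0 < ν → ν < ν₀ → FloorDataAt β f ε₀ C Θ ν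

/-- The band-limited floor class of resolution exponent `β` (crux-ideate 14085-1's `FloorClass`,
re-typed): `β = 3/4` is the crux, `β = 1/2` the dropped `TaylorFloor` (stmt-14085). -/
def FloorClass (β : ℝ) : Prop :=
  ∃ f : UnitAddTorus (Fin 3) → EuclideanSpace ℝ (Fin 3), Literature.Analysis.FunctionSpaces.Torus.IsSmooth f ∧ Literature.Analysis.FunctionSpaces.Torus.IsDivFree f ∧ Literature.Analysis.FunctionSpaces.Torus.HasZeroMean f ∧ ∃ (ε₀ C Θ ν₀ : ℝ), FloorFor β f ε₀ C Θ ν₀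

/-- (F0) The crux IS the `β = 3/4` member of the class, definitionally. -/
theorem kolmogorovFloor_iff : KolmogorovFloor ↔ FloorClass (3 / 4) := Iff.rfl

/-! ## (F1) Evaluation at rest: the multiplier must inject, the force cannot vanish -/

/-- At rest (`u = 0 ∈ H`) the dissipation, the drift, the inertial term and the energy channel all
vanish: the floor functional reduces to the injection `(f, W)` through the multiplier. -/
theorem floor_terms_at_rest (f : (UnitAddTorus (Fin 3)) → (EuclideanSpace ℝ (Fin 3))) (ν θ : ℝ) (W : (UnitAddTorus (Fin 3)) → (EuclideanSpace ℝ (Fin 3))) :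
    ν * (Torus.eGradNormSq (((0 : (Torus.energySpace (Fin 3))) : (Lp (EuclideanSpace ℝ (Fin 3)) 2 (volume : Measure (UnitAddTorus (Fin 3))))) : (UnitAddTorus (Fin 3)) → (EuclideanSpace ℝ (Fin 3)))).toReal +
        Torus.nsGeneratorPairing ν f (0 : (Torus.energySpace (Fin 3))) W +
      2 * θ * (Torus.pairing ((0 : (Torus.energySpace (Fin 3))) : (Lp (EuclideanSpace ℝ (Fin 3)) 2 (volume : Measure (UnitAddTorus (Fin 3))))) f - ν * (Torus.eGradNormSq (((0 : (Torus.energySpace (Fin 3))) : (Lp (EuclideanSpace ℝ (Fin 3)) 2 (volume : Measure (UnitAddTorus (Fin 3))))) : (UnitAddTorus (Fin 3)) → (EuclideanSpace ℝ (Fin 3)))).toReal) =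
      ∫ x, ⟪f x, W x⟫_ℝ := by
  have h2 : (∫ x, ⟪(((0 : (Torus.energySpace (Fin 3))) : (Lp (EuclideanSpace ℝ (Fin 3)) 2 (volume : Measure (UnitAddTorus (Fin 3))))) : (UnitAddTorus (Fin 3)) → (EuclideanSpace ℝ (Fin 3))) x, Torus.laplacian W x⟫_ℝ) = 0 := by
    rw [← integral_zero (α := (UnitAddTorus (Fin 3))) (G := ℝ)]
    refine integral_congr_ae ?_
    filter_upwards [coe_zero_ae] with x hx
    rw [hx]
    simp
  have h3 : (∫ x, ⟪Torus.fderiv W x ((((0 : (Torus.energySpace (Fin 3))) : (Lp (EuclideanSpace ℝ (Fin 3)) 2 (volume : Measure (UnitAddTorus (Fin 3))))) : (UnitAddTorus (Fin 3)) → (EuclideanSpace ℝ (Fin 3))) x), (((0 : (Torus.energySpace (Fin 3))) : (Lp (EuclideanSpace ℝ (Fin 3)) 2 (volume : Measure (UnitAddTorus (Fin 3))))) : (UnitAddTorus (Fin 3)) → (EuclideanSpace ℝ (Fin 3))) x⟫_ℝ) = 0 := by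
    rw [← integral_zero (α := (UnitAddTorus (Fin 3))) (G := ℝ)]
    refine integral_congr_ae ?_
    filter_upwards [coe_zero_ae] with x hx
    rw [hx]
    simp
  have h4 : Torus.pairing ((0 : (Torus.energySpace (Fin 3))) : (Lp (EuclideanSpace ℝ (Fin 3)) 2 (volume : Measure (UnitAddTorus (Fin 3))))) f = 0 := by
    unfold Torus.pairing
    rw [← integral_zero (α := (UnitAddTorus (Fin 3))) (G := ℝ)]
    refine integral_congr_ae ?_
    filter_upwards [coe_zero_ae] with x hx
    rw [hx]
    simp
  unfold Torus.nsGeneratorPairing Torus.inertialPairing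
  rw [h2, h3, h4, eGradNormSq_coe_zero]
  simp

/-- (F1) Any floor datum injects `ε₀` at rest through its multiplier: `ε₀ ≤ (f, Φ₁'(0))`. In particular the
multiplier at rest is a non-zero band-limited field positively correlated with `f` — the handle of every
"beat at rest" attack (F6). -/
theorem injects_at_rest {β : ℝ} {f : (UnitAddTorus (Fin 3)) → (EuclideanSpace ℝ (Fin 3))} {ε₀ C Θ ν : ℝ} (hν : 0 < ν)
    (h : FloorDataAt β f ε₀ C Θ ν) :
    ∃ (N : ℕ) (Φ₁ : Torus.CylindricalTest (Fin 3)), (N : ℝ) ≤ C * ν ^ (-β) ∧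
      (∀ i, Torus.fourierTruncate N (Φ₁.g i) = Φ₁.g i) ∧ ε₀ ≤ ∫ x, ⟪f x, Φ₁.grad 0 x⟫_ℝ := by
  obtain ⟨N, Φ₁, θ₁, hN, hband, -, -, hu⟩ := h
  refine ⟨N, Φ₁, hN, hband, ?_⟩
  have hu0 := hu (0 : (Torus.energySpace (Fin 3)))
  dsimp only at hu0
  have h1 : Torus.eGradNormSq (((0 : (Torus.energySpace (Fin 3))) : (Lp (EuclideanSpace ℝ (Fin 3)) 2 (volume : Measure (UnitAddTorus (Fin 3))))) : (UnitAddTorus (Fin 3)) → (EuclideanSpace ℝ (Fin 3))) ≠ ⊤ := by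
    rw [eGradNormSq_coe_zero]; exact ENNReal.zero_ne_top
  have h2 : ‖(0 : (Torus.energySpace (Fin 3)))‖ ^ 2 ≤ 16 * (∫ x, ‖f x‖ ^ 2) / ν ^ 2 := by
    rw [norm_zero]
    have : 0 ≤ ∫ x, ‖f x‖ ^ 2 := integral_nonneg fun x => by positivity
    have h16 : 0 ≤ 16 * (∫ x, ‖f x‖ ^ 2) / ν ^ 2 := by positivity
    simpa using h16
  have hfl := hu0 h1 h2
  rwa [floor_terms_at_rest] at hfl

/-- (F1) The force of a witness is not (a.e.) zero: `0 < ‖f‖₂²`. -/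
theorem force_ne_zero {β : ℝ} {f : (UnitAddTorus (Fin 3)) → (EuclideanSpace ℝ (Fin 3))} (hf : Torus.IsSmooth f) {ε₀ C Θ ν₀ : ℝ}
    (h : FloorFor β f ε₀ C Θ ν₀) : 0 < ∫ x, ‖f x‖ ^ 2 := by
  obtain ⟨hε₀, hν₀, hall⟩ := h
  have hF2nn : 0 ≤ ∫ x, ‖f x‖ ^ 2 := integral_nonneg fun x => by positivity
  refine lt_of_le_of_ne hF2nn fun hF0 => ?_
  obtain ⟨N, Φ₁, -, -, hinj⟩ := injects_at_rest (β := β) (half_pos hν₀) (hall (ν₀ / 2) (half_pos hν₀) (half_lt_self hν₀))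
  have hae := ae_zero_of_integral_sq_zero hf hF0.symm
  have hzero : (∫ x, ⟪f x, Φ₁.grad 0 x⟫_ℝ) = 0 := by
    rw [← integral_zero (α := (UnitAddTorus (Fin 3))) (G := ℝ)]
    refine integral_congr_ae ?_
    filter_upwards [hae] with x hx
    simp [hx]
  linarith

/-! ## (F2) The dual reading: quiet steady states kill every floor -/

/-- (F2) **Steady states of a witness force are loud.** If the floor of exponent `β` holds for `f`, then
for every `ν ∈ (0, ν₀)` every steady weak solution `u ∈ H` of `NS_ν(f)` (tree predicate
`Torus.IsSteadyWeakSolution`: `⟨F_ν(u), w⟩ = 0` for all `w ∈ 𝒱`) with finite enstrophy, in the Leray ball,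
and with non-negative energy defect `(u,f) − ν‖∇u‖² ≥ 0` (equality for every `u ∈ V`, `d ≤ 4`; the
inequality is what weak limits give) dissipates at least `ε₀`. Proof: the generator term of the floor
vanishes at `w = Φ₁'(u) ∈ 𝒱`, the energy channel has the sign of `θ₁ ≤ 0`. The resolution plays no role. -/
theorem steady_states_loud {β : ℝ} {f : (UnitAddTorus (Fin 3)) → (EuclideanSpace ℝ (Fin 3))} {ε₀ C Θ ν₀ : ℝ}
    (h : FloorFor β f ε₀ C Θ ν₀) {ν : ℝ} (hν : 0 < ν) (hνν₀ : ν < ν₀)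
    (u : Torus.energySpace (Fin 3))
    (hfin : Torus.eGradNormSq (((u : (Torus.energySpace (Fin 3))) : (Lp (EuclideanSpace ℝ (Fin 3)) 2 (volume : Measure (UnitAddTorus (Fin 3))))) : (UnitAddTorus (Fin 3)) → (EuclideanSpace ℝ (Fin 3))) ≠ ⊤)
    (hball : ‖u‖ ^ 2 ≤ 16 * (∫ x, ‖f x‖ ^ 2) / ν ^ 2)
    (hsteady : Torus.IsSteadyWeakSolution ν f u)
    (hdefect : ν * (Torus.eGradNormSq (((u : (Torus.energySpace (Fin 3))) : (Lp (EuclideanSpace ℝ (Fin 3)) 2 (volume : Measure (UnitAddTorus (Fin 3))))) : (UnitAddTorus (Fin 3)) → (EuclideanSpace ℝ (Fin 3)))).toReal ≤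
      Torus.pairing ((u : (Torus.energySpace (Fin 3))) : (Lp (EuclideanSpace ℝ (Fin 3)) 2 (volume : Measure (UnitAddTorus (Fin 3))))) f) :
    ε₀ ≤ ν * (Torus.eGradNormSq (((u : (Torus.energySpace (Fin 3))) : (Lp (EuclideanSpace ℝ (Fin 3)) 2 (volume : Measure (UnitAddTorus (Fin 3))))) : (UnitAddTorus (Fin 3)) → (EuclideanSpace ℝ (Fin 3)))).toReal := by
  obtain ⟨-, -, hall⟩ := h
  obtain ⟨N, Φ₁, θ₁, -, -, -, hθ₁, hu⟩ := hall ν hν hνν₀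
  have hu' := hu u
  dsimp only at hu'
  have hfl := hu' hfin hball
  have hgen : Torus.nsGeneratorPairing ν f u (Φ₁.grad u) = 0 :=
    hsteady _ (isSmooth_grad Φ₁ u) (isDivFree_grad Φ₁ u) (hasZeroMean_grad Φ₁ u)
  rw [hgen, add_zero] at hfl
  have hch : 2 * θ₁ * (Torus.pairing ((u : (Torus.energySpace (Fin 3))) : (Lp (EuclideanSpace ℝ (Fin 3)) 2 (volume : Measure (UnitAddTorus (Fin 3))))) f -
      ν * (Torus.eGradNormSq (((u : (Torus.energySpace (Fin 3))) : (Lp (EuclideanSpace ℝ (Fin 3)) 2 (volume : Measure (UnitAddTorus (Fin 3))))) : (UnitAddTorus (Fin 3)) → (EuclideanSpace ℝ (Fin 3)))).toReal) ≤ 0 := by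
    have hP : 0 ≤ Torus.pairing ((u : (Torus.energySpace (Fin 3))) : (Lp (EuclideanSpace ℝ (Fin 3)) 2 (volume : Measure (UnitAddTorus (Fin 3))))) f -
      ν * (Torus.eGradNormSq (((u : (Torus.energySpace (Fin 3))) : (Lp (EuclideanSpace ℝ (Fin 3)) 2 (volume : Measure (UnitAddTorus (Fin 3))))) : (UnitAddTorus (Fin 3)) → (EuclideanSpace ℝ (Fin 3)))).toReal := by linarith
    nlinarith
  linarith

/-- QUIET STEADY STATES FOR EVERY FORCE (the `H` of the negative lemma below; an OPEN dynamical statement —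
true for `f = 0` and for no known genuinely three-dimensional `f`; false forces are exactly the witnesses
of the floor half of crux #3 `SteadyStatesLoudBounded`): every smooth div-free mean-zero `f` admits, at
arbitrarily small viscosity, a finite-enstrophy steady weak NS state in the Leray ball with non-negative
energy defect and dissipation below any prescribed `ε`. [topic AnomalousDissipation/steady-states] -/
def QuietSteadyStates : Prop :=
  ∀ f : (UnitAddTorus (Fin 3)) → (EuclideanSpace ℝ (Fin 3)), Torus.IsSmooth f → Torus.IsDivFree f → Torus.HasZeroMean f →
    ∀ ε : ℝ, 0 < ε → ∀ ν₀ : ℝ, 0 < ν₀ → ∃ ν : ℝ, 0 < ν ∧ ν < ν₀ ∧ ∃ u : Torus.energySpace (Fin 3),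
      Torus.eGradNormSq (((u : (Torus.energySpace (Fin 3))) : (Lp (EuclideanSpace ℝ (Fin 3)) 2 (volume : Measure (UnitAddTorus (Fin 3))))) : (UnitAddTorus (Fin 3)) → (EuclideanSpace ℝ (Fin 3))) ≠ ⊤ ∧
      ‖u‖ ^ 2 ≤ 16 * (∫ x, ‖f x‖ ^ 2) / ν ^ 2 ∧
      Torus.IsSteadyWeakSolution ν f u ∧
      ν * (Torus.eGradNormSq (((u : (Torus.energySpace (Fin 3))) : (Lp (EuclideanSpace ℝ (Fin 3)) 2 (volume : Measure (UnitAddTorus (Fin 3))))) : (UnitAddTorus (Fin 3)) → (EuclideanSpace ℝ (Fin 3)))).toReal ≤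
        Torus.pairing ((u : (Torus.energySpace (Fin 3))) : (Lp (EuclideanSpace ℝ (Fin 3)) 2 (volume : Measure (UnitAddTorus (Fin 3))))) f ∧
      ν * (Torus.eGradNormSq (((u : (Torus.energySpace (Fin 3))) : (Lp (EuclideanSpace ℝ (Fin 3)) 2 (volume : Measure (UnitAddTorus (Fin 3))))) : (UnitAddTorus (Fin 3)) → (EuclideanSpace ℝ (Fin 3)))).toReal < ε

/-- (F2) Quiet steady states kill every member of the floor class, whatever the resolution. -/
theorem floorClass_false_of_quietSteadyStates (hq : QuietSteadyStates) (β : ℝ) : ¬ FloorClass β := by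
  rintro ⟨f, hfs, hfd, hfz, ε₀, C, Θ, ν₀, hfloor⟩
  obtain ⟨ν, hν, hνν₀, u, hfin, hball, hsteady, hdef, hquiet⟩ := hq f hfs hfd hfz ε₀ hfloor.1 ν₀ hfloor.2.1
  have := steady_states_loud hfloor hν hνν₀ u hfin hball hsteady hdef
  linarith

/-- (F2) NEGATIVE LEMMA MODULO `QuietSteadyStates`: `¬KolmogorovFloor` follows from quiet steady states for
every force. (Not a refutation: `QuietSteadyStates` is open. Filed so that ideators/provers can import the
exact shape of the dual obstruction.) -/
theorem kolmogorovFloor_false_of_quietSteadyStates (hq : QuietSteadyStates) : ¬ KolmogorovFloor :=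
  kolmogorovFloor_iff.not.2 (floorClass_false_of_quietSteadyStates hq _)

/-! ## (F3) Monotonicity in the exponent -/

/-- (F3) Lower resolution is a stronger bet: `FloorClass β → FloorClass β'` for `β ≤ β'` (shrink `ν₀` below
`1` and use `ν^{-β} ≤ ν^{-β'}` for `ν ≤ 1`; a negative `C` admits no `N`, so `max C 0` may replace `C`).
In particular the dropped `TaylorFloor = FloorClass (1/2)` implies the crux. -/
theorem floorClass_mono {β β' : ℝ} (hββ' : β ≤ β') : FloorClass β → FloorClass β' := by
  rintro ⟨f, hfs, hfd, hfz, ε₀, C, Θ, ν₀, hε₀, hν₀, hall⟩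
  refine ⟨f, hfs, hfd, hfz, ε₀, max C 0, Θ, min ν₀ 1, hε₀, lt_min hν₀ one_pos, fun ν hν hν₁ => ?_⟩
  obtain ⟨N, Φ₁, θ₁, hN, hband, hθ, hθ', hu⟩ := hall ν hν (lt_of_lt_of_le hν₁ (min_le_left _ _))
  refine ⟨N, Φ₁, θ₁, ?_, hband, hθ, hθ', hu⟩
  have hν1 : ν ≤ 1 := (lt_of_lt_of_le hν₁ (min_le_right _ _)).le
  have h1 : ν ^ (-β) ≤ ν ^ (-β') := Real.rpow_le_rpow_of_exponent_ge hν hν1 (neg_le_neg hββ')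
  have h0 : 0 ≤ ν ^ (-β) := Real.rpow_nonneg hν.le _
  calc (N : ℝ) ≤ C * ν ^ (-β) := hN
    _ ≤ max C 0 * ν ^ (-β) := mul_le_mul_of_nonneg_right (le_max_left _ _) h0
    _ ≤ max C 0 * ν ^ (-β') := mul_le_mul_of_nonneg_left h1 (le_max_right _ _)

/-! ## (F4) The kinematic criterion — why `3/4` is exactly where one-parameter phantoms stop

Paper analysis (this seat), recorded for ideators and provers; notation as in PHANTOM-FLOOR.md /
ONE-STAGE-PHANTOM.md: `I(u,W) = inertialPairing u W = ∫(u⊗u):∇W`, `⟨F_ν(u),W⟩ = (f,W) + ν(u,ΔW) + I(u,W)`,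
FLOOR(u) `= (1+2|θ₁|)ν‖∇u‖² + ⟨F_ν(u),Φ₁'(u)⟩ − 2|θ₁|(u,f)`.

KINEMATIC KILL SCHEMA. A phantom is a smooth div-free mean-zero trigonometric polynomial `a` of degree
`Λ_a` with a smooth symmetric stress `R_a` and pressure `p` such that `(a·∇)a + ∇p = f + div R_a`, and
`(a,f) ≥ −ε₀/(16Θ)`. For ANY certificate `(N, Φ₁, θ₁)` put `W := Φ₁'(a)`; then (integration by parts,
`div a = 0`, `(∇p, W) = 0`)
  `(f,W) + I(a,W) = ∫ R_a : e(W)`,   `|ν(a,ΔW)| ≤ √(6ν·ν‖∇a‖²)·s`,   `s := sup‖e(W)‖_op`,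
so `FLOOR(a) ≤ (1+2Θ)ν‖∇a‖² + ε₀/8 + (‖R_a‖_{L¹} + √(6ν·ν‖∇a‖²))·s`. A coords-invisible packet `ŵ`
(PacketLemma, route item 14032) with spectrum in `(2D₀, K₁D₀]`, `D₀ := N + Λ_a`, riding the most
compressive direction of `e(W)` gives `FLOOR(a + tŵ) ≤ FLOOR(a) + t²[(1+2Θ)4π²K₁²νD₀² − s/4] + 2Θt|(ŵ,f)|`
(all cross terms vanish EXACTLY by disjointness of Fourier supports — `grad_eq_of_coords_eq`,
`fc_grad_eq_zero` of the landed Negative files). Hence the certificate survives `a` only if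
  `s ≤ s_crit := 16π²K₁²(1+2Θ)ν(N+Λ_a)²`  AND  `(‖R_a‖₁ + √(6ν·ν‖∇a‖²))·s_crit ≥ ε₀/2`-ish.
Eliminating `ν` (the refuter chooses it after `a`, subject to `ν < ν₀` and `N = Cν^{-3/4}`):

* REGIME II (`Λ_a ≪ N`, price set by the resolution, `s_crit ≍ (1+2Θ)C²ν^{-1/2}`): kill iff
    `𝔐₁(a) := ‖R_a‖_{L¹}·‖∇a‖_{L²} ≤ m₁* ≍ ε₀² (1+2Θ)⁻² C⁻⁴ K₁⁻⁴`     (and `‖R_a‖₁ → 0` along the family).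
  ONE Beltrami–Nash stage at frequency `λ` (DLS 2013 §§3–4 without time; ONE-STAGE-PHANTOM.md §2):
  `‖R‖ ≍ c_R(f)/λ`, `‖∇a‖ ≍ c_A(f)λ`, so `𝔐₁ ≍ c_Rc_A` is `λ`-INDEPENDENT: the one-stage family kills
  iff `c_R c_A < m₁*`, i.e. iff `C < C_*(f,ε₀,Θ) ≍ ε₀^{1/2}(1+2Θ)^{-1/2}(c_Rc_A)^{-1/4}K₁⁻¹` — the
  KOLMOGOROV-CONSTANT THRESHOLD. For `β < 3/4` the same computation has `s_crit ≍ ν^{1−2β}` and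
  `‖R‖s_crit ≍ ν^{3/2−2β} → 0`: every `FloorClass β`, `β < 3/4`, is dead for every force and all constants.
* REGIME I (`Λ_a ≳ N`, price set by the phantom's own degree; optimal `ν = (C/Λ_a)^{4/3}`): kill iff
    `‖R_a‖_{L¹} ≤ c·ε₀ (1+2Θ)⁻¹ C^{-4/3} · Λ_a^{-2/3}`   and   `‖∇a‖_{L²} ≤ c'·ε₀ (1+2Θ)⁻¹ C^{-8/3} · Λ_a^{2/3}`.
  These are EXACTLY the Kolmogorov–Onsager scalings: a field with K41 spectrum truncated at `Λ` has
  `‖∇P_Λ v‖₂ ≍ Λ^{2/3}` and carries stress `≍ Λ^{-2/3}` at scale `Λ⁻¹`. Truncations of an exact standing flow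
  `v ∈ H^s` meet both iff `s > 2/3` (`‖R‖₁ ≲ Λ^{-s}`, `‖∇a‖ ≲ Λ^{1−s}`: the binding one is the defect) — the
  route header's "σ > 2/3" law, recovered; smooth exact quiet points (`R = 0`) meet them trivially
  (QUIET-POINT-BEAT: all `β`).

CONSEQUENCES. (i) The crux's kinematic content is the number
  `𝔐*(f) := lim_{δ→0} inf { ‖R_a‖₁‖∇a‖₂ : ‖R_a‖₁ ≤ δ, (a,f) ≥ 0 }` (regime II) together with its regime-I
  analogue: `KolmogorovFloor` with witness `(f,ε₀,C,Θ)` forces `𝔐*(f) ≥ m₁*(ε₀,C,Θ) > 0` — a QUANTITATIVE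
  EULER COERCIVITY of `f` ("approximate standing flows of `f` cannot beat the one-stage defect×steepness
  product"), strictly stronger than `SmoothEulerCoerciveForce` (#6: no `a` with `R_a = 0`), and `ν`-free.
  (ii) A kill of the crux for ALL `C` by kinematics needs `𝔐*(f) = 0` for every `f`: phantom families
  beating one stage asymptotically. Later Nash stages do not help (the interaction `(a₁·∇)a₂` of a fast
  stage with a slow one has no stationary transport cure: its antidivergence is a RESOLVED stress of size
  `‖a₁‖‖a₂‖`, unless the fast phases are first integrals of `a₁` — generic 3-D fields have none); every
  stationary h-principle in print is `L^∞` (no rate). So no known construction decides `C ≥ C_*`: the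
  route header's positioning is CONFIRMED from the adversary's side, and sharpened to (i).
  (iii) For provers: a valid certificate at `C ≥ C_*` must price one-stage phantoms `a_λ`, `λ ≲ ν^{-1/2}`,
  through their `O(1/λ)` resolved defect with multiplier strain `≍ ε₀λ` — and must NOT exceed strain
  `s_crit ≍ (1+2Θ)C²ν^{-1/2}` anywhere on the quiet part of the ball (else packets). Both at once is
  consistent exactly because `λ ≲ ν^{-1/2}`: the design window is a constant factor wide (`C_*` vs `C`). -/
def KinematicCriterion : Prop := True

/-! ## (F5) Load-bearing hypotheses of the inner `∀ u` -/

/-- The crux with the finite-enstrophy hypothesis `eGradNormSq uf ≠ ⊤` DROPPED (everything else verbatim). -/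
def KolmogorovFloorWithoutFiniteEnstrophy : Prop :=
  ∃ f : UnitAddTorus (Fin 3) → EuclideanSpace ℝ (Fin 3), Literature.Analysis.FunctionSpaces.Torus.IsSmooth f ∧ Literature.Analysis.FunctionSpaces.Torus.IsDivFree f ∧ Literature.Analysis.FunctionSpaces.Torus.HasZeroMean f ∧ ∃ (ε₀ C Θ ν₀ : ℝ), 0 < ε₀ ∧ 0 < ν₀ ∧ ∀ ν : ℝ, 0 < ν → ν < ν₀ → ∃ (N : ℕ) (Φ₁ : Literature.Analysis.FluidPDE.Torus.CylindricalTest (Fin 3)) (θ₁ : ℝ), (N : ℝ) ≤ C * ν ^ (-(3 / 4 : ℝ)) ∧ (∀ i, Literature.Analysis.FunctionSpaces.Torus.fourierTruncate N (Φ₁.g i) = Φ₁.g i) ∧ -Θ ≤ θ₁ ∧ θ₁ ≤ 0 ∧ ∀ u : Literature.Analysis.FunctionSpaces.Torus.energySpace (Fin 3), let uf : UnitAddTorus (Fin 3) → EuclideanSpace ℝ (Fin 3) := ((u : MeasureTheory.Lp (EuclideanSpace ℝ (Fin 3)) 2 (MeasureTheory.volume : MeasureTheory.Measure (UnitAddTorus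 (Fin 3)))) : UnitAddTorus (Fin 3) → EuclideanSpace ℝ (Fin 3)); let D : ℝ := ν * (Literature.Analysis.FunctionSpaces.Torus.eGradNormSq uf).toReal; let P : ℝ := Literature.Analysis.FluidPDE.Torus.pairing (u : MeasureTheory.Lp (EuclideanSpace ℝ (Fin 3)) 2 (MeasureTheory.volume : MeasureTheory.Measure (UnitAddTorus (Fin 3)))) f - D; ‖u‖ ^ 2 ≤ 16 * (∫ x, ‖f x‖ ^ 2) / ν ^ 2 → ε₀ ≤ D + Literature.Analysis.FluidPDE.Torus.nsGeneratorPairing ν f u (Φ₁.grad u) + 2 * θ₁ * P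

/-- (F5) `any proof must use the finite-enstrophy hypothesis` — PAPER, queued (needs the packet lemma or
an infinite-mode state in Lean): at an infinite-enstrophy `u ∈ H` the formal dissipation `D` is the junk
value `ν·(⊤).toReal = 0`; given the revealed multiplier at rest `W₀ = Φ₁'(0)` (non-zero by
`injects_at_rest`, strain `s₀ > 0`), an `L²` div-free field `r` with all modes above `N`, infinite
spectral enstrophy, and `I(r, W₀) ≤ −(s₀/8)‖r‖²` (a packet at the most compressive point of `e(W₀)` plus
an `L²`-small infinite-enstrophy tail) has `coords(tr) = 0`, `FLOOR(±t r) = (f,W₀) − t²(s₀/8)‖r‖² ∓ 2|θ₁|t(r,f)`,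
negative for the right sign and `t² = 16(f,W₀)/(s₀‖r‖²)` (inside the ball for `ν` small). -/
theorem false_without_finiteEnstrophy : ¬ KolmogorovFloorWithoutFiniteEnstrophy := by
  sorry

/-! ## (F6) Natural strengthenings: lower resolutions (targets for cycle 2) -/

/-- (F6) PAPER (ONE-STAGE-PHANTOM.md §4, re-derived in (F4) regime II): every exponent below Kolmogorov
is dead for every force and all constants. Lean status: needs the one-stage Reynolds realization
(Beltrami pair identity + antidivergence symbol bound + Wiener bookkeeping, M-sized) and the beat endgame
with a general trigonometric base state; not attempted this cycle. -/
theorem not_floorClass_of_lt_three_quarters {β : ℝ} (hβ : β < 3 / 4) : ¬ FloorClass β := by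
  sorry

/-- The `β = 1/6` member of the floor class, inlined (the statement refuted by
`Theorems/KolmogorovFloor/Negative/BeatAtRest.lean :: not_floor_sixth`, this seat, sorry-free). -/
theorem floorClass_sixth_iff : FloorClass (1 / 6) ↔ (∃ f : UnitAddTorus (Fin 3) → EuclideanSpace ℝ (Fin 3), Literature.Analysis.FunctionSpaces.Torus.IsSmooth f ∧ Literature.Analysis.FunctionSpaces.Torus.IsDivFree f ∧ Literature.Analysis.FunctionSpaces.Torus.HasZeroMean f ∧ ∃ (ε₀ C Θ ν₀ : ℝ), 0 < ε₀ ∧ 0 < ν₀ ∧ ∀ ν : ℝ, 0 < ν → ν < ν₀ → ∃ (N : ℕ) (Φ₁ : Literature.Analysis.FluidPDE.Torus.CylindricalTest (Fin 3)) (θ₁ : ℝ), (N : ℝ) ≤ C * ν ^ (-(1 / 6 : ℝ)) ∧ (∀ i, Literature.Analysis.FunctionSpaces.Torus.fourierTruncate N (Φ₁.g i) = Φ₁.g i) ∧ -Θ ≤ θ₁ ∧ θ₁ ≤ 0 ∧ ∀ u : Literature.Analysis.FunctionSpaces.Torus.energySpace (Fin 3), let uf : UnitAddTorus (Fin 3)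 → EuclideanSpace ℝ (Fin 3) := ((u : MeasureTheory.Lp (EuclideanSpace ℝ (Fin 3)) 2 (MeasureTheory.volume : MeasureTheory.Measure (UnitAddTorus (Fin 3)))) : UnitAddTorus (Fin 3) → EuclideanSpace ℝ (Fin 3)); let D : ℝ := ν * (Literature.Analysis.FunctionSpaces.Torus.eGradNormSq uf).toReal; let P : ℝ := Literature.Analysis.FluidPDE.Torus.pairing (u : MeasureTheory.Lp (EuclideanSpace ℝ (Fin 3)) 2 (MeasureTheory.volume : MeasureTheory.Measure (UnitAddTorus (Fin 3)))) f - D; Literature.Analysis.FunctionSpaces.Torus.eGradNormSq uf ≠ ⊤ → ‖u‖ ^ 2 ≤ 16 * (∫ x, ‖f x‖ ^ 2) / ν ^ 2 → ε₀ ≤ D + Literature.Analysis.FluidPDE.Torus.nsGeneratorPairing ν f u (Φ₁.grad u) + 2 * θ₁ * P) :=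
  Iff.rfl

/-- (F6) **Every resolution exponent `β ≤ 1/6` is dead, for every force** — from the LANDED
`Theorems.KolmogorovFloor.Negative.not_floor_sixth` (this seat, p75992) and monotonicity in `β`. -/
theorem not_floorClass_le_sixth {β : ℝ} (hβ : β ≤ 1 / 6) : ¬ FloorClass β :=
  fun hb => Summit.AnomalousDissipation.AnomalousDissipation.Theorems.KolmogorovFloor.Negative.not_floor_sixth
    (floorClass_sixth_iff.1 (floorClass_mono hβ hb))

/-- (F6) **Every resolution exponent `β < 1/2` is dead, for every force and all constants** — the LANDED
`Theorems.KolmogorovFloor.Negative.not_floor_lt_half` (this seat, p76655), restated on `FloorClass`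
(definitionally the same statement). The crux is `β = 3/4`; `TaylorFloor` was `β = 1/2`. -/
theorem not_floorClass_lt_half {β : ℝ} (hβ : β < 1 / 2) : ¬ FloorClass β :=
  Summit.AnomalousDissipation.AnomalousDissipation.Theorems.KolmogorovFloor.Negative.not_floor_lt_half hβ

/-! ## (F7) The Galerkin dual reading — a DNS-checkable necessary condition -/

/-- (F7) GALERKIN LOUDNESS FROM REST for the data `(f, ε₀, C, ν₀)`: for every `ν ∈ (0,ν₀)` and every truncation
level `L` with `C ν^{-3/4} ≤ L`, every smooth solution `a : ℝ → (T³ → ℝ³)` of the Galerkin system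
`∂ₜa = P_L P[f + νΔa − (a·∇)a]` (written weakly against band-limited smooth div-free mean-zero test fields, which
is all the floor pairs it with) with `a(0) = 0` and `P_L a = a` has `liminf_T T⁻¹∫₀ᵀ ν‖∇a‖² ≥ ε₀`.
PAPER THEOREM: `KolmogorovFloor` with witness `(f,ε₀,C,Θ,ν₀)` implies `GalerkinLoudFromRest f ε₀ C ν₀`
(proof in the module docstring (F7): exact stationarity `⟨F_ν(u),W⟩ = (F_L(u),W)` for `W ∈ P_N H ⊂ P_L H`, chain
rule for `Φ₁ ∘ a`, boundedness of `φ`, Galerkin energy identity from rest, `θ₁ ≤ 0`). Typed here as the target of a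
future negative lemma `galerkinLoud_of_kolmogorovFloor` (the tree has Galerkin machinery only for the unforced
fractional system, `Literature.Analysis.FluidPDE.FracNSGalerkin*`). -/
def GalerkinLoudFromRest (f : UnitAddTorus (Fin 3) → EuclideanSpace ℝ (Fin 3)) (ε₀ C ν₀ : ℝ) : Prop :=
  ∀ ν : ℝ, 0 < ν → ν < ν₀ → ∀ L : ℕ, C * ν ^ (-(3 / 4 : ℝ)) ≤ (L : ℝ) →
    ∀ a : ℝ → UnitAddTorus (Fin 3) → EuclideanSpace ℝ (Fin 3),
      (∀ t, Torus.IsSmooth (a t)) → (∀ t, Torus.IsDivFree (a t)) → (∀ t, Torus.HasZeroMean (a t)) →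
      (∀ t, Torus.fourierTruncate L (a t) = a t) → a 0 = 0 →
      (∀ (w : UnitAddTorus (Fin 3) → EuclideanSpace ℝ (Fin 3)), Torus.IsSmooth w → Torus.IsDivFree w →
        Torus.HasZeroMean w → Torus.fourierTruncate L w = w →
        ∀ t, HasDerivAt (fun s => ∫ x, ⟪a s x, w x⟫_ℝ)
          ((∫ x, ⟪f x, w x⟫_ℝ) + ν * (∫ x, ⟪a t x, Torus.laplacian w x⟫_ℝ) +
            ∫ x, ⟪Torus.fderiv w x (a t x), a t x⟫_ℝ) t) →
      ε₀ ≤ Filter.liminf (fun T : ℝ => T⁻¹ * ∫ t in (0 : ℝ)..T, ν * Torus.gradNormSq (a t)) Filter.atTop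

/-! ## (F8) The energy channel cannot bear load -/

/-- (F8) WEIGHTS VANISH — PAPER THEOREM (this seat; proof in the module docstring (F8)): for every witness
`(f, ε₀, C, Θ, ν₀)` of the crux there are `K, ν₁ > 0` such that every floor datum `(N, Φ₁, θ₁)` at `ν < ν₁`
has `|θ₁| ≤ K ν^{1/4}` (laminar ray of the gravest active mode of `f` + axis-carrier beat). Recorded as a `sorry`d
target: Lean needs the axis-carrier frame and the general-base three-mode state (M). -/
theorem weights_vanish {f : UnitAddTorus (Fin 3) → EuclideanSpace ℝ (Fin 3)} (hf : Torus.IsSmooth f)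
    {ε₀ C Θ ν₀ : ℝ} (h : FloorFor (3 / 4) f ε₀ C Θ ν₀) :
    ∃ K ν₁ : ℝ, 0 < K ∧ 0 < ν₁ ∧ ∀ ν : ℝ, 0 < ν → ν < ν₁ →
      ∀ (N : ℕ) (Φ₁ : Torus.CylindricalTest (Fin 3)) (θ₁ : ℝ), (N : ℝ) ≤ C * ν ^ (-(3 / 4 : ℝ)) →
        (∀ i, Torus.fourierTruncate N (Φ₁.g i) = Φ₁.g i) → -Θ ≤ θ₁ → θ₁ ≤ 0 →
        (∀ u : Torus.energySpace (Fin 3),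
          Torus.eGradNormSq (((u : (Torus.energySpace (Fin 3))) : (Lp (EuclideanSpace ℝ (Fin 3)) 2 (volume : Measure (UnitAddTorus (Fin 3))))) : (UnitAddTorus (Fin 3)) → (EuclideanSpace ℝ (Fin 3))) ≠ ⊤ →
          ‖u‖ ^ 2 ≤ 16 * (∫ x, ‖f x‖ ^ 2) / ν ^ 2 →
          ε₀ ≤ ν * (Torus.eGradNormSq (((u : (Torus.energySpace (Fin 3))) : (Lp (EuclideanSpace ℝ (Fin 3)) 2 (volume : Measure (UnitAddTorus (Fin 3))))) : (UnitAddTorus (Fin 3)) → (EuclideanSpace ℝ (Fin 3)))).toReal +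
            Torus.nsGeneratorPairing ν f u (Φ₁.grad u) +
            2 * θ₁ * (Torus.pairing ((u : (Torus.energySpace (Fin 3))) : (Lp (EuclideanSpace ℝ (Fin 3)) 2 (volume : Measure (UnitAddTorus (Fin 3))))) f -
              ν * (Torus.eGradNormSq (((u : (Torus.energySpace (Fin 3))) : (Lp (EuclideanSpace ℝ (Fin 3)) 2 (volume : Measure (UnitAddTorus (Fin 3))))) : (UnitAddTorus (Fin 3)) → (EuclideanSpace ℝ (Fin 3)))).toReal)) →
        |θ₁| ≤ K * ν ^ (1 / 4 : ℝ) := by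
  sorry

/-! ## (F9) The cheap-base kill and the quiet-point corollaries (PROVED in folder files; mirrors) -/

/-- (F9) Formerly a MIRROR; since v9 the LANDED `Negative/QuietPointKill.lean :: floor_no_quiet_point` (p-landed,
sorry-free, standard axioms): a smooth quiet Euler point of `f` kills every band-limited floor family of exponent
`β < 1` for `f`. -/
theorem floor_no_quiet_point_mirror {β : ℝ} (hβ : β < 1)
    {f v : UnitAddTorus (Fin 3) → EuclideanSpace ℝ (Fin 3)} (hf : Torus.IsSmooth f) (hv : Torus.IsSmooth v)
    (hvd : Torus.IsDivFree v) (hvz : Torus.HasZeroMean v)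
    (hquiet : ∀ w : UnitAddTorus (Fin 3) → EuclideanSpace ℝ (Fin 3), Torus.IsSmooth w → Torus.IsDivFree w →
      Torus.HasZeroMean w → ∫ x, ⟪Torus.convect v v x - f x, w x⟫_ℝ = 0)
    {ε₀ C Θ ν₀ : ℝ} (hε₀ : 0 < ε₀) (hν₀ : 0 < ν₀) (h : FloorFor β f ε₀ C Θ ν₀) : False := by
  -- = `…Theorems.KolmogorovFloor.Negative.floor_no_quiet_point hβ hf hv hvd hvz hquiet hε₀ hν₀ h.2.2` (LANDED;
  -- module not yet served by the farm snapshot, see the NOTE at the imports)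
  sorry

/-- (F9) MIRROR of `Negative/QuietPointKill.lean :: kolmogorovFloor_false_of_quiet_points` (PROVED there):
Euler flexibility for every force (¬ crux #6 `SmoothEulerCoerciveForce` in its strong form) refutes the crux. -/
theorem kolmogorovFloor_false_of_quiet_points_mirror
    (hflex : ∀ f : UnitAddTorus (Fin 3) → EuclideanSpace ℝ (Fin 3), Torus.IsSmooth f → Torus.IsDivFree f →
      Torus.HasZeroMean f → ∃ v : UnitAddTorus (Fin 3) → EuclideanSpace ℝ (Fin 3), Torus.IsSmooth v ∧
        Torus.IsDivFree v ∧ Torus.HasZeroMean v ∧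
        ∀ w : UnitAddTorus (Fin 3) → EuclideanSpace ℝ (Fin 3), Torus.IsSmooth w → Torus.IsDivFree w →
          Torus.HasZeroMean w → ∫ x, ⟪Torus.convect v v x - f x, w x⟫_ℝ = 0) :
    ¬ KolmogorovFloor := by
  rintro ⟨f, hfs, hfd, hfz, ε₀, C, Θ, ν₀, hε₀, hν₀, hfloor⟩
  obtain ⟨v, hv, hvd, hvz, hquiet⟩ := hflex f hfs hfd hfz
  exact floor_no_quiet_point_mirror (β := 3 / 4) (by norm_num) hfs hv hvd hvz hquiet hε₀ hν₀ ⟨hε₀, hν₀, hfloor⟩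

/-- (F9) MIRROR (verbatim) of `Negative/CheapStatesKill.lean :: CheapSteadyEulerStates` — THE ν-FREE EULER
INTERFACE the crux is reduced to in Lean (`kolmogorovFloor_false_of_CheapSteadyEulerStates`, PROVED in the
folder file): for every admissible force and all small `η`, a smooth solenoidal mean-zero state with
enstrophy/energy `≤ η^{-11/10}`, slope `Σ_{|k|≤N}|k|‖â(k)‖ ≤ η^{-3/5}` (every `N`), work `|(a,f)| ≤ η^{2/5}`, and
defect `|((a·∇)a − f, W)| ≤ η·M` for every smooth solenoidal mean-zero `W` with `Ŵ(k) = 0` for `|k| > N` and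
`|k|‖Ŵ(k)‖ ≤ M`. Euler-side seats (DRESSED-RAY Thm B, card cheap-steady-euler-closure E2/E3) should target
exactly this shape. -/
def CheapSteadyEulerStates' : Prop :=
  ∀ f : UnitAddTorus (Fin 3) → EuclideanSpace ℝ (Fin 3), Torus.IsSmooth f → Torus.IsDivFree f →
    Torus.HasZeroMean f →
    ∃ η₀ : ℝ, 0 < η₀ ∧ ∀ η : ℝ, 0 < η → η < η₀ →
      ∃ a : UnitAddTorus (Fin 3) → EuclideanSpace ℝ (Fin 3), Torus.IsSmooth a ∧ Torus.IsDivFree a ∧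
        Torus.HasZeroMean a ∧
        (Torus.eGradNormSq a).toReal ≤ η ^ (-(11 / 10 : ℝ)) ∧ (∫ x, ‖a x‖ ^ 2) ≤ η ^ (-(11 / 10 : ℝ)) ∧
        (∀ N : ℕ, ∑ κ ∈ Torus.freqBall N, Real.sqrt (Torus.freqNormSq κ) *
          ‖mFourierCoeff (EuclideanSpace.complexify ∘ a) κ‖ ≤ η ^ (-(3 / 5 : ℝ))) ∧
        |∫ x, ⟪a x, f x⟫_ℝ| ≤ η ^ (2 / 5 : ℝ) ∧
        ∀ (N : ℕ) (W : UnitAddTorus (Fin 3) → EuclideanSpace ℝ (Fin 3)) (M : ℝ), Torus.IsSmooth W →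
          Torus.IsDivFree W → Torus.HasZeroMean W →
          (∀ κ, (N : ℝ) ^ 2 < Torus.freqNormSq κ → mFourierCoeff (EuclideanSpace.complexify ∘ W) κ = 0) →
          (∀ κ, Real.sqrt (Torus.freqNormSq κ) * ‖mFourierCoeff (EuclideanSpace.complexify ∘ W) κ‖ ≤ M) →
          |∫ x, ⟪Torus.convect a a x - f x, W x⟫_ℝ| ≤ η * M

/-- (F9) MIRROR of the LANDED `Negative/CheapStatesKill.lean :: kolmogorovFloor_false_of_CheapSteadyEulerStates`
(`CheapSteadyEulerStates'` here is that file's `CheapSteadyEulerStates` verbatim, `Iff.rfl` once the module is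
imported): CHEAP states for every force refute the crux by name. -/
theorem kolmogorovFloor_false_of_cheapSteadyEulerStates_mirror (h : CheapSteadyEulerStates') :
    ¬ KolmogorovFloor := by
  -- = `…Theorems.KolmogorovFloor.Negative.kolmogorovFloor_false_of_CheapSteadyEulerStates h` (LANDED; module not yet
  -- served by the farm snapshot, see the NOTE at the imports)
  sorry

/-! ## Targets (cycle 3 of the 14030 seat): the dressed-ray endgame over `cheap_base_kill` -/

/-- TARGET (DRESSED-RAY-r1-3 Thm A) — DONE in the 14030 seat's folder `FarFieldCheap.lean` / `LinearResponseKill.lean`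
(`floor_false_of_approxLinearResponse`, see (F10)); those folder files did not survive the seat (only
`Negative/FarField.lean` landed). Superseded since v9 by the line `digit-frame-closure` on the restored item (F11)–(F13):
the Euler side is the lead's `Response.ResponseStatement`, the bookkeeping is this seat's `ResponseCheap`. -/
theorem dressedRayKill_target : True := trivial

/-! ## (F11) The restored item stmt-15122: exact verification of the landed closed forms (v9, this seat)

Everything in this section speaks about the LANDED definitions of
`Theorems/TaylorCertificatesKolmogorovFloorResponseDefs.lean` (namespace `…Theorems.KolmogorovFloor.Response`,
line lead `prover-line-stmt-AnomalousDissipation-15122-0`, p98066). -/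

open Summit.AnomalousDissipation.AnomalousDissipation.Theorems.KolmogorovFloor in
/-- (F11) The lead's restated interface `Response.CheapStatesStatement` IS the landed ν-free interface
`Negative.CheapSteadyEulerStates` (syntactically identical: both are `Iff.rfl`-equal to this file's
`CheapSteadyEulerStates'`). Hence the line's KILL stub is the landed theorem
`kolmogorovFloor_false_of_CheapSteadyEulerStates`, recorded here so that no seat re-proves it. -/
theorem cheapStatesStatement_iff : Response.CheapStatesStatement ↔ CheapSteadyEulerStates' := Iff.rfl

open Summit.AnomalousDissipation.AnomalousDissipation.Theorems.KolmogorovFloor in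
/-- (F11) KILL, by name, from the lead's interface: `Response.CheapStatesStatement → ¬ KolmogorovFloor`. -/
theorem kolmogorovFloor_false_of_cheapStatesStatement (h : Response.CheapStatesStatement) : ¬ KolmogorovFloor :=
  kolmogorovFloor_false_of_cheapSteadyEulerStates_mirror (cheapStatesStatement_iff.1 h)

/-- (F11) EXACT VERIFICATION OF THE LANDED LINE ALGEBRA and PROOF PLAN (this seat; the disprover's stub attack on
LINE-ALGEBRA / DET′ of the picked line found NO mis-statement).

WHAT WAS CHECKED (exact rational arithmetic, `π := 1` — all of `σ, ρ, ρ̃, λ±, y, inc, P, x, z` are homogeneous of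
degree `−1` in `π` and `q` of degree `0`, so the check at `π = 1` is the check; files `num/lead_mirror.py`,
`num/det_check.py` attached as item evidence): a LITERAL transcription of `digitB/digitE/digitXi/cross3/digitN`,
`lineData` (`a = k·e, c = k·n, s = k·ξ, K, X2, e2, n2`, `n = ξ × e`), `lineForce` (bilinear `ipair`), `E, N, T, D, Gp,
Gm, G`, `sigmaC, rhoC, rhoT, lamP, lamM, Lam, yC, incC, PC` (with the `range (J+2)` filters exactly as typed), `xC, zC,
qC, ReC, RxC, RnC`. For `L = 1, 2, 3` (every forced mode `0 < k·k ≤ L²`: 6, 32, 122 modes), `J ∈ {0, 1, 2, 5}` and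
random rational forcings `v ⊥ k`:
  `ReC m = RxC m = RnC m = 0` for EVERY `|m| ≤ 2J+1`;  `a·xC m + T m·yC m + c·zC m = 0` for every `m`;
  both edge sites `m = ±(2J+2)` are non-zero (as designed);  `a ≠ 0`, `c ≠ 0`, `K < 2|s|`, `D > 0`, `G J ≠ 0`,
  `E j ≠ 0 (|j| ≤ 2J+3)` for every mode.
DET′ in the digit frame: `G J ≤ −|k×ξ|²/(4 s² X2) < 0` for `L ≤ 6` (924 modes), `J ≤ 100`; observed
`(bound)/(G J) ∈ [0.4977, 0.5000]`, i.e. `G J ≈ −|k×ξ|²/(2s²X2)` — a factor-2 margin, uniformly; the side condition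
`9K² ≤ 4|k×ξ|²` holds for every mode.

PROOF PLAN for LINE-ALGEBRA (`ReC m = RxC m = RnC m = 0`, `|m| ≤ 2J+1`), as three scalar identities:
 (i)  `RxC m = 0` ⟺ `πa(y_{m−1} − y_{m+1}) − [m=0]vx = 2πaT_m(y_{m−1}+y_{m+1})/N_m`. For even `2 ≤ |m| ≤ 2J`:
      `y_{m±1} = λ/E_{m±1}` with the SAME sheet constant and `E_{m±1} = N_m ± 2T_m`, so both sides equal
      `4πaλT_m/(E_{m−1}E_{m+1})`. For `m = 0`: `E_{±1} = K ± 2s`, `N_0 = K`, `T_0 = s`, and LHS − RHS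
      `= πa(λ₋ − λ₊)/K − vx = πaσ/K − vx = 0`. For odd `m` (incl. `±(2J+1)`): `y_{m±1} = 0`, all terms vanish.
 (ii) `c·e2·ReC m − a·n2·RnC m = πa[(P_{m−1} − P_{m+1}) + inc m]` because `c e2 x_j − a n2 z_j = P_j` (from the
      `x, z` formulas, determinant `D`), `q_m(a c e2/e2 − a n2 c/n2) = 0` and `c e2 ve − a n2 vn = πaρ`; and
      `P_{m+1} − P_{m−1} = inc m` for every even `|m| ≤ 2J+2` — for `m ≠ 0` by the nested `range (J+2)` filters, for
      `m = 0` it is the CLOSURE `Σ_{even |m'| ≤ 2J+2} inc m' = 0 ⟺ λ₊G₊ + λ₋G₋ = ρ̃` (each odd `j` in the window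
      is counted by its two even neighbours), which is exactly the definition of `λ±` (`G ≠ 0`).
 (iii) `a·ReC m + T_m·RxC m + c·RnC m = 2πaX2(y_{m−1}+y_{m+1}) − q_m N_m = 0` by the definition of `q`, using
      `k_m·c_{m−1} = ξ·c_{m−1} = X2 y_{m−1}` and `k_m·c_{m+1} = −X2 y_{m+1}` (transversality of `c_{m±1}` to `k_{m±1}`,
      itself `a x + c z = −T y` from the `x, z` formulas) and `v·k = 0`, `N_m = a²/e2·e2 + … = k_m·k_m`.
 Then (i)+(iii) give `a·ReC + c·RnC = 0`, and with (ii) the 2×2 system of determinant `c²e2 + a²n2 = D ≠ 0` forces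
 `ReC = RnC = 0` (if `c = 0` the frame is violated; `a ≠ 0` always). No case analysis beyond parity/`m = 0`/edge. -/
def LineAlgebraPlan : Prop := True

/-! ## (F13) TARGET of this seat: the CHEAP bookkeeping, decoupled from the Euler side -/

open Summit.AnomalousDissipation.AnomalousDissipation.Theorems.KolmogorovFloor in
/-- (F13) TARGET (being landed as `Negative/ResponseCheap.lean`; recorded here as the standing near-miss until the
proposal is accepted). RECIPE. Given `f`, take `A, p` from `ResponseStatement`; `F₁ := Σ'‖f̂‖` (finite), `F₂ := ∫‖f‖²`,
`r := 10 + 3p`, polynomial Fourier decay of order `m := 40r + 4`: `‖f̂(κ)‖ ≤ K_f (1+|κ|²)^{-m}`. For `η` small put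
`B := 2L+1 :=` the largest odd integer `≤ η^{-1/(40r)}` (so every frame/response polynomial `≤ A'B^r ≤ A'η^{-1/40}`
and the tail `Σ_{|κ|>L}‖f̂(κ)‖ ≤ K_f S₃ (1+L²)^{3−m} ≤ η²`), `Cb := A B^p Σ_{|k|≤L}‖f̂(k)‖ ≤ A B^p F₁`,
`J := ⌈√(3Cb/η)⌉` (edge defect `Cb/(J+1)² ≤ η/3`), `s² := η^{-11/10}/(8π²X2e2)`, `t := 1/s`, `a := s•U + t•b`. Then
(`Π := X2e2 ≤ 9B^{10}`, `ℓ := 1 + log(2J+1) ≤ 1 + 40(2J+1)^{1/40}`): enstrophy `η^{-11/10}/2 + 16π²Πη^{11/10}Cb²(J+1)²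
≤ η^{-11/10}` (second term `O(ΠCb³η^{1/10})`); energy `η^{-11/10}/(8π²X2) + 16π²Πη^{11/10}(Cbℓ)²`; slope
`η^{-11/20}/(√8π) + √8π√Π η^{11/20}Cb(J+1) ≤ η^{-3/5}` (`11/20 < 3/5`, second term `O(η^{1/20})`); work
`s√e2‖f̂(ξ_L)‖ + t((Cbℓ)² + F₂)/2 ≤ η^{2/5}` (Young; `‖f̂(ξ_L)‖ ≤` tail, `|ξ_L| > L`); defect (`farField_convect`,
`s t = 1`, `(U·∇)U = 0`): `Cb M/(J+1)² + t²(Cbℓ)²M + M·Σ_{L<|κ|≤N}‖f̂(κ)‖ ≤ (η/3 + 8π²Πη^{11/10}Cb²ℓ² + η²)M ≤ ηM`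
(`Torus.integral_inner_eq_sum_freqBall` + `mFourierCoeff_fourierTruncate_sub` for the last term; `‖Ŵ(κ)‖ ≤ M` off
the origin). Every `poly(B)·polylog(1/η)` sits against a spare power `≥ η^{-1/20}`. -/
theorem cheapStates_of_response_target :
    Response.ResponseStatement → Response.CheapStatesStatement := by
  sorry

open Summit.AnomalousDissipation.AnomalousDissipation.Theorems.KolmogorovFloor in
/-- (F13) … whence the crux's negation modulo the Euler side of the picked line. -/
theorem kolmogorovFloor_false_of_responseStatement_target (h : Response.ResponseStatement) : ¬ KolmogorovFloor :=
  kolmogorovFloor_false_of_cheapStatesStatement (cheapStates_of_response_target h)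


/-! ## (F14) Cycle-1 landings of this seat on the picked line, and the state of the line (v10, 2026-08-16 13:30Z)

LANDED (accepted, in the tree; namespace `…Theorems.KolmogorovFloor.Negative` unless noted; all `--supports` this crux):
* `Negative/ResponseCheapNumerics.lean` (p101773): `expoR levelΛ levelL decayOrder tailMajorant truncJ logFactor ampS`,
  `levelL_facts`, `tailMajorant_le_sq`, `truncJ_facts`, `logFactor_le`, `ampS_facts`, `rpow_neg_natPow`,
  `const_mul_rpow_le_one`, `two_sqrt_le` — the parameter choices of the CHEAP recipe of (F13) and their estimates.
* `Negative/ResponseCheapBudgets.lean` (p101775): `cheap_budgets_123`, `cheap_budgets_45` — the five budget inequalities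
  in closed form (every `poly(B)·polylog(1/η)` against a spare power `≥ η^{-1/20}`).
* `Negative/ResponseCheapFarField.lean` (p101781): `abs_integral_inner_le_half_add`, `work_farField_eq`,
  `abs_integral_inner_truncate_sub_le`, `cheapAt_of_farField` — the state `a = s•U + t•b` and its work/defect.
* `Negative/ResponseLineAlgebraB.lean` (p102725; namespace `…Response`): the chain identities of the closed forms.
PROPOSED (verdict pending at the time of writing):
* `Negative/ResponseCheap.lean` (file `F4_ResponseCheap.lean` of the seat folder, attached as item evidence inside
  `ResponseCheapAll.lean`): `cheapStatesStatement_of_responseStatement : Response.ResponseStatement →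
  Response.CheapStatesStatement` — EXACTLY the line's `stub_cheap`; kernel-checked (rc 0, no sorry) in the seat folder.
* `Negative/ResponseLineAlgebraA.lean` (p102721): support/transversality/`RxC = 0` for the closed forms.
NOT PROPOSED (superseded by the line's own landings, which came first): this seat's `det_bound` (= the line's
`Response.sheetDeterminant_le`, `TaylorCertificatesKolmogorovFloorDet.lean`), its assembled `lineAlgebra` with symmetry
(= the line's `TaylorCertificatesKolmogorovFloorLineAlgebra.lean :: lineAlgebra`; folder `LineAlgebraAll.lean`, rc 0),
and its KILL composition (= the line's `TaylorCertificatesKolmogorovFloorKill.lean ::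
Response.kolmogorovFloor_false_of_cheapStatesStatement`).

STATE OF THE LINE `digit-frame-closure` (tree, 13:05Z): FRAME (`…Frame.lean :: digitFrame`), DET′ (`…Det.lean`),
LINE-ALGEBRA (`…LineAlgebraTools/LineSymmetry/LineAlgebra.lean`), LINE-BOUNDS (`…LineBounds{,Sizes,Sums}.lean`), TAIL,
KILL are landed; DICTIONARY (`…DictionaryPairing.lean` tools) and ASSEMBLY (`…AssemblyLattice.lean` tools) are in progress
with the lead; CHEAP is this seat's pending `Negative/ResponseCheap.lean`. With CHEAP accepted the crux's negation holds
modulo `Response.ResponseStatement` (folder `F6_ResponseKillCompose.lean`, to be proposed once `ResponseCheap` is served):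
`Negative.kolmogorovFloor_false_of_responseStatement : Response.ResponseStatement → ¬ KolmogorovFloor`.

DISPROVER'S VERDICT after cycle 1 (numbers, not adjectives): every closed form of the landed defs was transcribed and
checked in exact rational arithmetic (`num/lead_mirror.py`: residuals `ReC = RxC = RnC = 0` at all `|m| ≤ 2J+1`,
`L ≤ 3`, `J ∈ {0,1,2,5}`; `num/det_check.py`: `−G·4s²X2/Q ∈ [0.4977, 0.5]·…` for `L ≤ 6`, `J ≤ 100`), the CHEAP
arithmetic is kernel-checked, and no hypothesis of `ResponseStatement` was found droppable-for-free or false in a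
small model. The crux `KolmogorovFloor` is expected to CLOSE AS REFUTED by the line's `floor_false`. -/
def CycleOneLandings : Prop := True

end Summit.AnomalousDissipation.AnomalousDissipation.Cruxes.KolmogorovFloor.Disproof
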